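import Summits.AnomalousDissipation.AnomalousDissipation.Theorems.SawtoothPulseCascadeK1LocalisedCascadeFibreWindow

/-!
# K1loc, line `Spectral` / thin start — helper: THE WINDOW LEMMA WITH TWO SEPARATED INPUT PARTS (S-D step)

Helper file of the prover lane on the crux `K1LocalisedCascade` (stmt-AnomalousDissipation-19491), route
`SawtoothPulseCascade` (S-D fibre ledger).  `…FibreWindow.sum_window_sq_norm_comp_shearMap_le` bounds the window energy of
`(θ₁ + θ₂) ∘ Φ` when ONE part `θ₁` is spectrally separated from the window by ONE splitting of the chirp.  The ledger's
resonant-shell step needs TWO separated parts with DIFFERENT chirp splittings on the same fibre (modes far below the shell are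
separated by a mid-band/high-band split, modes far above it by a low-pass/high-pass split):
* `sum_window_sq_norm_comp_shearMap_le₂` — for `θ = θ₁ + θ₁' + θ₂` with exact separations `ĝ^rest_n(m)·𝓕θ₁(k − m eⱼ) = 0`,
  `ĝ^rest'_n(m)·𝓕θ₁'(k − m eⱼ) = 0` (`k ∈ W`) and pointwise bounds `‖g^mid_n‖ ≤ ρ`, `‖g^mid'_n‖ ≤ ρ'`:
  `Σ_{k∈W}‖𝓕(θ∘Φ)(k)‖² ≤ (√(∫ρ(x_j)²‖θ₁‖²) + √(∫ρ'(x_j)²‖θ₁'‖²) + √(∫‖θ₂‖²))²`.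
Same proof (chirp reduction per fibre, Bessel, Parseval across fibres, Minkowski with three terms).  No definitions; no
statement about the crux. [cite: Grafakos2014, Prop. 3.1.2 (5) and Prop. 3.2.7 (3)] [problem: turb]
-/

-- `Summit.<Summit>.<Problem>`: single-conjunct summit, the duplicate namespace segment is deliberate.
set_option linter.dupNamespace false

noncomputable section

namespace Summit.AnomalousDissipation.AnomalousDissipation.Theorems.SawtoothPulseCascade.K1Window

open MeasureTheory Set Filter Topology UnitAddTorus Function
open scoped ENNReal
open Literature.Analysis.FunctionSpaces Literature.Analysis.FunctionSpaces.Torus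
open Summit.AnomalousDissipation.AnomalousDissipation.Theorems.SawtoothPulseCascade.K1Start

variable {d : Type*} [Fintype d] [DecidableEq d]

/-- The fibre-sum bound for one separated part: `Σ_{k∈W} ‖𝓕(g^mid_{kᵢ}(x_j)·A^i_{kᵢ}θ₁)(k)‖² ≤ ∫ρ(x_j)²‖θ₁‖²` when
`‖g^mid_n‖ ≤ ρ` on the fibres met by `W`. [cite: Grafakos2014, Prop. 3.2.7 (3)] -/
theorem sum_sq_norm_mid_le {θ₁ : UnitAddTorus d → ℂ} (hθ₁ : Continuous θ₁) {i j : d} (hij : i ≠ j)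
    (W : Finset (d → ℤ)) (gmid : ℤ → UnitAddCircle → ℂ) (hgmid : ∀ n, Continuous (gmid n))
    {ρ : UnitAddCircle → ℝ} (hρ : Continuous ρ) (hρ0 : ∀ b, 0 ≤ ρ b) (hbd : ∀ k ∈ W, ∀ b, ‖gmid (k i) b‖ ≤ ρ b) :
    ∑ k ∈ W, ‖mFourierCoeff (fun x => gmid (k i) (x j) *
        ∫ s : UnitAddCircle, (fourier (-(k i)) s : ℂ) • θ₁ (x + Pi.single i s)) k‖ ^ 2 ≤
      ∫ x : UnitAddTorus d, ρ (x j) ^ 2 * ‖θ₁ x‖ ^ 2 := by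
  classical
  set A₁ : ℤ → UnitAddTorus d → ℂ := fun n x => ∫ s : UnitAddCircle, (fourier (-n) s : ℂ) • θ₁ (x + Pi.single i s) with hA₁
  set H₁ : ℤ → UnitAddTorus d → ℂ := fun n x => gmid n (x j) * A₁ n x with hH₁
  have hA₁c : ∀ n, Continuous (A₁ n) := fun n => continuous_twistedAxisAvg hθ₁ i n
  have hH₁c : ∀ n, Continuous (H₁ n) := fun n => ((hgmid n).comp (continuous_apply j)).mul (hA₁c n)
  set F : Finset ℤ := W.image fun k => k i with hF
  have hmaps : ∀ k ∈ W, k i ∈ F := fun k hk => Finset.mem_image_of_mem _ hk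
  have hfib : ∑ k ∈ W, ‖mFourierCoeff (H₁ (k i)) k‖ ^ 2 ≤ ∑ n ∈ F, ∫ x : UnitAddTorus d, ‖H₁ n x‖ ^ 2 := by
    rw [← Finset.sum_fiberwise_of_maps_to hmaps]
    refine Finset.sum_le_sum fun n hn => ?_
    calc ∑ k ∈ W with k i = n, ‖mFourierCoeff (H₁ (k i)) k‖ ^ 2
        = ∑ k ∈ W with k i = n, ‖mFourierCoeff (H₁ n) k‖ ^ 2 :=
          Finset.sum_congr rfl fun k hk => by rw [(Finset.mem_filter.mp hk).2]
      _ ≤ ∫ x : UnitAddTorus d, ‖H₁ n x‖ ^ 2 := sum_sq_norm_mFourierCoeff_le_integral (hH₁c n) _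
  have hbdF : ∀ n ∈ F, ∀ b, ‖gmid n b‖ ≤ ρ b := by
    intro n hn b
    obtain ⟨k, hk, rfl⟩ := Finset.mem_image.mp hn
    exact hbd k hk b
  refine hfib.trans ?_
  set v : UnitAddTorus d → ℂ := fun x => ((ρ (x j) : ℝ) : ℂ) * θ₁ x with hv
  have hvc : Continuous v := (Complex.continuous_ofReal.comp (hρ.comp (continuous_apply j))).mul hθ₁
  set Av : ℤ → UnitAddTorus d → ℂ := fun n x => ∫ s : UnitAddCircle, (fourier (-n) s : ℂ) • v (x + Pi.single i s) with hAv
  have hAv_eq : ∀ n x, Av n x = ((ρ (x j) : ℝ) : ℂ) * A₁ n x := fun n x =>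
    twistedAxisAvg_mul_comp_eval (fun b => ((ρ b : ℝ) : ℂ)) θ₁ hij n x
  have hle : ∀ n ∈ F, ∫ x : UnitAddTorus d, ‖H₁ n x‖ ^ 2 ≤ ∫ x : UnitAddTorus d, ‖Av n x‖ ^ 2 := by
    intro n hn
    refine integral_mono_of_nonneg (Eventually.of_forall fun x => sq_nonneg _)
      (((continuous_norm.comp (continuous_twistedAxisAvg hvc i n)).pow 2).integrable_unitAddTorus)
      (Eventually.of_forall fun x => ?_)
    simp only [hH₁, hAv_eq, norm_mul, Complex.norm_real, Real.norm_eq_abs, abs_of_nonneg (hρ0 _)]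
    exact pow_le_pow_left₀ (by positivity) (mul_le_mul_of_nonneg_right (hbdF n hn _) (norm_nonneg _)) 2
  refine (Finset.sum_le_sum hle).trans ?_
  have hP := hasSum_integral_twistedAxisAvg_sq hvc i
  have heq : ∫ x : UnitAddTorus d, ‖v x‖ ^ 2 = ∫ x : UnitAddTorus d, ρ (x j) ^ 2 * ‖θ₁ x‖ ^ 2 :=
    integral_congr_ae (Eventually.of_forall fun x => by
      simp only [hv, norm_mul, Complex.norm_real, Real.norm_eq_abs, mul_pow, sq_abs])
  rw [← heq]
  exact sum_le_hasSum F (fun n _ => integral_nonneg fun x => sq_nonneg _) hP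

/-- **The window lemma with two separated parts.**  See the file header. [cite: Grafakos2014, Prop. 3.1.2 (5) and Prop. 3.2.7 (3)] -/
theorem sum_window_sq_norm_comp_shearMap_le₂ {θ₁ θ₁' θ₂ : UnitAddTorus d → ℂ} (hθ₁ : Continuous θ₁)
    (hθ₁s : Summable fun k => ‖mFourierCoeff θ₁ k‖) (hθ₁' : Continuous θ₁')
    (hθ₁'s : Summable fun k => ‖mFourierCoeff θ₁' k‖) (hθ₂ : Continuous θ₂) {i j : d} (hij : i ≠ j)
    (P : ShearProfile) (W : Finset (d → ℤ))
    (gmid grest gmid' grest' : ℤ → UnitAddCircle → ℂ) (hgmid : ∀ n, Continuous (gmid n))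
    (hgrest : ∀ n, Continuous (grest n)) (hgmid' : ∀ n, Continuous (gmid' n)) (hgrest' : ∀ n, Continuous (grest' n))
    (hsplit : ∀ k ∈ W, ∀ b, twist P (k i) b = gmid (k i) b + grest (k i) b)
    (hsplit' : ∀ k ∈ W, ∀ b, twist P (k i) b = gmid' (k i) b + grest' (k i) b)
    (hsep : ∀ k ∈ W, ∀ m : ℤ, fourierCoeff (grest (k i)) m * mFourierCoeff θ₁ (k - Pi.single j m) = 0)
    (hsep' : ∀ k ∈ W, ∀ m : ℤ, fourierCoeff (grest' (k i)) m * mFourierCoeff θ₁' (k - Pi.single j m) = 0)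
    {ρ ρ' : UnitAddCircle → ℝ} (hρ : Continuous ρ) (hρ0 : ∀ b, 0 ≤ ρ b) (hbd : ∀ k ∈ W, ∀ b, ‖gmid (k i) b‖ ≤ ρ b)
    (hρ' : Continuous ρ') (hρ'0 : ∀ b, 0 ≤ ρ' b) (hbd' : ∀ k ∈ W, ∀ b, ‖gmid' (k i) b‖ ≤ ρ' b) :
    ∑ k ∈ W, ‖mFourierCoeff ((fun x => θ₁ x + θ₁' x + θ₂ x) ∘ shearMap i j P) k‖ ^ 2 ≤
      (Real.sqrt (∫ x : UnitAddTorus d, ρ (x j) ^ 2 * ‖θ₁ x‖ ^ 2) +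
        Real.sqrt (∫ x : UnitAddTorus d, ρ' (x j) ^ 2 * ‖θ₁' x‖ ^ 2) +
        Real.sqrt (∫ x : UnitAddTorus d, ‖θ₂ x‖ ^ 2)) ^ 2 := by
  classical
  set H₁ : ℤ → UnitAddTorus d → ℂ := fun n x => gmid n (x j) *
    ∫ s : UnitAddCircle, (fourier (-n) s : ℂ) • θ₁ (x + Pi.single i s) with hH₁
  set H₁' : ℤ → UnitAddTorus d → ℂ := fun n x => gmid' n (x j) *
    ∫ s : UnitAddCircle, (fourier (-n) s : ℂ) • θ₁' (x + Pi.single i s) with hH₁'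
  set H₂ : ℤ → UnitAddTorus d → ℂ := fun n x => twist P n (x j) *
    ∫ s : UnitAddCircle, (fourier (-n) s : ℂ) • θ₂ (x + Pi.single i s) with hH₂
  have hH₂c : ∀ n, Continuous (H₂ n) := fun n =>
    ((continuous_twist P n).comp (continuous_apply j)).mul (continuous_twistedAxisAvg hθ₂ i n)
  -- Step 1: coefficients on the window
  have hcoef : ∀ k ∈ W, mFourierCoeff ((fun x => θ₁ x + θ₁' x + θ₂ x) ∘ shearMap i j P) k =
      mFourierCoeff (H₁ (k i)) k + mFourierCoeff (H₁' (k i)) k + mFourierCoeff (H₂ (k i)) k := by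
    intro k hk
    have hsum : ((fun x => θ₁ x + θ₁' x + θ₂ x) ∘ shearMap i j P) =
        (θ₁ ∘ shearMap i j P) + (θ₁' ∘ shearMap i j P) + (θ₂ ∘ shearMap i j P) := by
      funext x; rfl
    have hI1 := (hθ₁.comp (continuous_shearMap i j P)).integrable_unitAddTorus
    have hI1' := (hθ₁'.comp (continuous_shearMap i j P)).integrable_unitAddTorus
    have hI2 := (hθ₂.comp (continuous_shearMap i j P)).integrable_unitAddTorus
    rw [hsum, Torus.mFourierCoeff_add (F := ℂ) (hI1.add hI1') hI2, Torus.mFourierCoeff_add (F := ℂ) hI1 hI1',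
      mFourierCoeff_comp_shearMap_eq_mid hθ₁ hθ₁s hij P (hgmid (k i)) (hgrest (k i)) k (hsplit k hk) (hsep k hk),
      mFourierCoeff_comp_shearMap_eq_mid hθ₁' hθ₁'s hij P (hgmid' (k i)) (hgrest' (k i)) k (hsplit' k hk) (hsep' k hk),
      mFourierCoeff_comp_shearMap_eq_chirp hθ₂ hij P k]
  -- Step 2: Minkowski with three terms
  have hM : ∑ k ∈ W, ‖mFourierCoeff ((fun x => θ₁ x + θ₁' x + θ₂ x) ∘ shearMap i j P) k‖ ^ 2 ≤
      (Real.sqrt (∑ k ∈ W, ‖mFourierCoeff (H₁ (k i)) k‖ ^ 2) + Real.sqrt (∑ k ∈ W, ‖mFourierCoeff (H₁' (k i)) k‖ ^ 2) +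
        Real.sqrt (∑ k ∈ W, ‖mFourierCoeff (H₂ (k i)) k‖ ^ 2)) ^ 2 := by
    have h1 : ∑ k ∈ W, ‖mFourierCoeff ((fun x => θ₁ x + θ₁' x + θ₂ x) ∘ shearMap i j P) k‖ ^ 2 ≤
        ∑ k ∈ W, ((‖mFourierCoeff (H₁ (k i)) k‖ + ‖mFourierCoeff (H₁' (k i)) k‖) + ‖mFourierCoeff (H₂ (k i)) k‖) ^ 2 := by
      refine Finset.sum_le_sum fun k hk => ?_
      rw [hcoef k hk]
      exact pow_le_pow_left₀ (norm_nonneg _) ((norm_add_le _ _).trans (add_le_add (norm_add_le _ _) le_rfl)) 2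
    have h2 := SpectralLeakage.sqrt_sum_add_sq_le W
      (a := fun k => ‖mFourierCoeff (H₁ (k i)) k‖ + ‖mFourierCoeff (H₁' (k i)) k‖)
      (b := fun k => ‖mFourierCoeff (H₂ (k i)) k‖) (fun k _ => by positivity) (fun k _ => norm_nonneg _)
    have h3 := SpectralLeakage.sqrt_sum_add_sq_le W (a := fun k => ‖mFourierCoeff (H₁ (k i)) k‖)
      (b := fun k => ‖mFourierCoeff (H₁' (k i)) k‖) (fun k _ => norm_nonneg _) (fun k _ => norm_nonneg _)
    have h0 : 0 ≤ ∑ k ∈ W, ((‖mFourierCoeff (H₁ (k i)) k‖ + ‖mFourierCoeff (H₁' (k i)) k‖) +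
        ‖mFourierCoeff (H₂ (k i)) k‖) ^ 2 := Finset.sum_nonneg fun k _ => sq_nonneg _
    calc ∑ k ∈ W, ‖mFourierCoeff ((fun x => θ₁ x + θ₁' x + θ₂ x) ∘ shearMap i j P) k‖ ^ 2
        ≤ ∑ k ∈ W, ((‖mFourierCoeff (H₁ (k i)) k‖ + ‖mFourierCoeff (H₁' (k i)) k‖) + ‖mFourierCoeff (H₂ (k i)) k‖) ^ 2 := h1
      _ = (Real.sqrt (∑ k ∈ W, ((‖mFourierCoeff (H₁ (k i)) k‖ + ‖mFourierCoeff (H₁' (k i)) k‖) +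
            ‖mFourierCoeff (H₂ (k i)) k‖) ^ 2)) ^ 2 := (Real.sq_sqrt h0).symm
      _ ≤ (Real.sqrt (∑ k ∈ W, (‖mFourierCoeff (H₁ (k i)) k‖ + ‖mFourierCoeff (H₁' (k i)) k‖) ^ 2) +
            Real.sqrt (∑ k ∈ W, ‖mFourierCoeff (H₂ (k i)) k‖ ^ 2)) ^ 2 :=
          pow_le_pow_left₀ (Real.sqrt_nonneg _) h2 2
      _ ≤ _ := pow_le_pow_left₀ (add_nonneg (Real.sqrt_nonneg _) (Real.sqrt_nonneg _)) (add_le_add h3 le_rfl) 2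
  -- Step 3: the three fibre sums
  have hA := sum_sq_norm_mid_le hθ₁ hij W gmid hgmid hρ hρ0 hbd
  have hA' := sum_sq_norm_mid_le hθ₁' hij W gmid' hgmid' hρ' hρ'0 hbd'
  have hB : ∑ k ∈ W, ‖mFourierCoeff (H₂ (k i)) k‖ ^ 2 ≤ ∫ x : UnitAddTorus d, ‖θ₂ x‖ ^ 2 := by
    set F : Finset ℤ := W.image fun k => k i with hF
    have hmaps : ∀ k ∈ W, k i ∈ F := fun k hk => Finset.mem_image_of_mem _ hk
    have hfib : ∑ k ∈ W, ‖mFourierCoeff (H₂ (k i)) k‖ ^ 2 ≤ ∑ n ∈ F, ∫ x : UnitAddTorus d, ‖H₂ n x‖ ^ 2 := by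
      rw [← Finset.sum_fiberwise_of_maps_to hmaps]
      refine Finset.sum_le_sum fun n hn => ?_
      calc ∑ k ∈ W with k i = n, ‖mFourierCoeff (H₂ (k i)) k‖ ^ 2
          = ∑ k ∈ W with k i = n, ‖mFourierCoeff (H₂ n) k‖ ^ 2 :=
            Finset.sum_congr rfl fun k hk => by rw [(Finset.mem_filter.mp hk).2]
        _ ≤ ∫ x : UnitAddTorus d, ‖H₂ n x‖ ^ 2 := sum_sq_norm_mFourierCoeff_le_integral (hH₂c n) _
    refine hfib.trans ?_
    have heq : ∀ n, ∫ x : UnitAddTorus d, ‖H₂ n x‖ ^ 2 =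
        ∫ x : UnitAddTorus d, ‖∫ s : UnitAddCircle, (fourier (-n) s : ℂ) • θ₂ (x + Pi.single i s)‖ ^ 2 := fun n =>
      integral_congr_ae (Eventually.of_forall fun x => by simp only [hH₂, norm_mul, norm_twist, one_mul])
    simp_rw [heq]
    exact sum_le_hasSum F (fun n _ => integral_nonneg fun x => sq_nonneg _) (hasSum_integral_twistedAxisAvg_sq hθ₂ i)
  have hsA := Real.sqrt_le_sqrt hA
  have hsA' := Real.sqrt_le_sqrt hA'
  have hsB := Real.sqrt_le_sqrt hB
  exact hM.trans (pow_le_pow_left₀ (by positivity) (add_le_add (add_le_add hsA hsA') hsB) 2)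

end Summit.AnomalousDissipation.AnomalousDissipation.Theorems.SawtoothPulseCascade.K1Window
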